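import Summits.BirchSwinnertonDyer.Rank1Residual.CoatesSujathaConjectureA
import Summits.BirchSwinnertonDyer.Rank1Residual.FineSelmerGcdProblemsEdges
import Literature.NumberTheory.EllipticCurves.IwasawaAlgebraProofs
import HarnessLib

/-!
# Kernel edges of the leaf `CoatesSujathaConjectureA`: the pointwise `μ = 0` reading and
# «(Gr) ⇒ Conjecture A» (Lei–Sujatha 2021, §1) for `E/ℚ` — PROVED bookkeeping, nothing asserted
# (typing layer D-0088(4), cell `bsd-littype`, seat 11, gen 4)

* `moduleFinite_int_iff_muInvariant_eq_zero` — for a dual datum `D` of `Sel₀` that is finitely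
  generated and torsion over `Λ` (Kato over `ℚ`; displayed): "`D.X` finitely generated over `ℤ_p`
  ⟺ `μ(D.X) = 0`" (tree theorem `muInvariant_eq_zero_iff_holds`, Washington §13.2) — the equivalence
  quoted by Lei–Sujatha ("which is equivalent to saying that its `μ`-invariant is zero").
* `conjectureA_at_of_greenbergFineSelmerProblem` — granted Greenberg's fine-Selmer problem (Gr)
  (leaf `GreenbergFineSelmerProblem`, OPEN, displayed as `h`), the CONCLUSION of Conjecture A at a pair
  `(E/ℚ, p)` (`p` odd), for the cyclotomic `κ`: given a topological generator `γ`, a dual datum `D` over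
  `(κ, γ)` finitely generated and torsion over `Λ`, and the printed exponents `e` with a stationarity
  level `N` (displayed), there are `γ, D` with `D.X` finitely generated over `ℤ_p` — via
  `FineSelmer.muInvariant_eq_zero_of_greenbergFineSelmerProblem` (p484220). CLOSES NOTHING.
References: [LeiSujatha2021] §1; [CoatesSujatha2005] Conj. A; [Washington1997] §13.2.
-/

set_option autoImplicit false

noncomputable section

open scoped Classical

open WeierstrassCurve Literature.NumberTheory.EllipticCurves

namespace Summit.BirchSwinnertonDyer.Rank1Residual.FineSelmer

universe u

/-- **`Y(E/K^{cyc})` finitely generated over `ℤ_p` ⟺ `μ = 0`**, for a dual datum of the fine Selmer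
group that is finitely generated and torsion over `Λ` (the equivalence quoted by Lei–Sujatha §1;
Washington §13.2, tree theorem `muInvariant_eq_zero_iff_holds`). [cite: LeiSujatha2021, §1] [cite: Washington1997, §13.2] -/
theorem moduleFinite_int_iff_muInvariant_eq_zero {K : Type u} [Field K] [NumberField K]
    {W : WeierstrassCurve K} {p : ℕ} [Fact p.Prime] {κ : ZpExtension K p}
    {γ : Field.absoluteGaloisGroup K} (D : W.FineSelmerDualData κ γ)
    [Module.Finite (IwasawaAlgebra p) D.X] (hX : Module.IsTorsion (IwasawaAlgebra p) D.X) :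
    Module.Finite ℤ_[p] (RestrictScalars ℤ_[p] (IwasawaAlgebra p) D.X) ↔ muInvariant p D.X = 0 :=
  (muInvariant_eq_zero_iff_holds p D.X hX).symm

/-- **«If (Gr) holds, then Conjecture A of [CS] holds as well» (Lei–Sujatha 2021, §1), in the leaf's
spelling**: granted `GreenbergFineSelmerProblem`, for elliptic `W/ℚ`, odd `p`, the cyclotomic `κ` with
a topological generator `γ`, a dual datum `D` of `Sel₀(E/ℚ_cyc)` finitely generated and torsion over
`Λ` (Kato; displayed), and printed exponents `e` with a stationarity level `N` (displayed): the
conclusion of `CoatesSujathaConjectureA` at `(ℚ, W, p, κ)`. [cite: LeiSujatha2021, §1] -/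
theorem conjectureA_at_of_greenbergFineSelmerProblem (h : GreenbergFineSelmerProblem)
    (W : WeierstrassCurve ℚ) [W.IsElliptic] (p : ℕ) [Fact p.Prime] (hp : p ≠ 2)
    (κ : ZpExtension ℚ p) (γ : Field.absoluteGaloisGroup ℚ) (hκ : κ.IsCyclotomic)
    (hγ : κ.IsTopGenerator γ) (e : ℕ → ℕ) (he₀ : e 0 = W.mordellWeilRank)
    (he₁ : e 1 * (p - 1) = (W.baseChange (κ.layer 1)).mordellWeilRank - W.mordellWeilRank)
    (he : ∀ n : ℕ, 2 ≤ n → e n * (p ^ (n - 1) * (p - 1)) =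
      (W.baseChange (κ.layer n)).mordellWeilRank - (W.baseChange (κ.layer (n - 1))).mordellWeilRank)
    (N : ℕ) (hN : ∀ n : ℕ, N < n → e n = 0)
    (D : W.FineSelmerDualData κ γ) [Module.Finite (IwasawaAlgebra p) D.X]
    (hX : Module.IsTorsion (IwasawaAlgebra p) D.X) :
    ∃ (γ' : Field.absoluteGaloisGroup ℚ) (D' : W.FineSelmerDualData κ γ'),
      Module.Finite ℤ_[p] (RestrictScalars ℤ_[p] (IwasawaAlgebra p) D'.X) :=
  ⟨γ, D, (moduleFinite_int_iff_muInvariant_eq_zero D hX).mpr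
    (muInvariant_eq_zero_of_greenbergFineSelmerProblem h W p hp κ γ hκ hγ e he₀ he₁ he N hN D hX)⟩

/-- Conversely, **Conjecture A gives `μ = 0` for every finitely generated torsion dual datum over the
witnessing generator** (pointwise reading used by the X8 / Conj-A lines).
[cite: LeiSujatha2021, §1] [cite: Washington1997, §13.2] -/
theorem exists_muInvariant_eq_zero_of_conjectureA (h : CoatesSujathaConjectureA)
    (K : Type) [Field K] [NumberField K] (W : WeierstrassCurve K) [W.IsElliptic] (p : ℕ) [Fact p.Prime]
    (hp : p ≠ 2) (κ : ZpExtension K p) (hκ : κ.IsCyclotomic) :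
    ∃ (γ : Field.absoluteGaloisGroup K) (D : W.FineSelmerDualData κ γ),
      ∀ [Module.Finite (IwasawaAlgebra p) D.X], Module.IsTorsion (IwasawaAlgebra p) D.X →
        muInvariant p D.X = 0 := by
  obtain ⟨γ, D, hD⟩ := h K W p hp κ hκ
  exact ⟨γ, D, fun hX ↦ (moduleFinite_int_iff_muInvariant_eq_zero D hX).mp hD⟩

end Summit.BirchSwinnertonDyer.Rank1Residual.FineSelmer

end
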